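import Summits.Ventures.CertifiedManyBodySolver.Observables.StiffnessApexTransportCurtain
import HarnessLib

/-!
# Ventures/CertifiedManyBodySolver — Observables/StiffnessApexTransportCurtainLadder.lean

HONEST FRAMING: one-sided certified CEILINGS on the uniform flux stiffness (`t–t′` f-sum class) at half filling, transported into a `(t′, U)` box
from a LADDER of stations, each with a short CORNER-OBJECTIVE overhang; a ceiling never speaks to the presence of order; not a `T_c` estimate, not a
superconductivity verdict; every leaf is CONDITIONAL on the row families it names. Zero compute, no definition, no claim node, no `sorry`.

Cell `pub/hubbard-downfold` (D-0150 L-DF2 «box ↦ one word»), seat `hubbard-downfold-unc-2` (`prover-hubbard-downfold-unc-2-g15-0`); companion of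
`Observables/StiffnessApexTransportCurtain.lean` ((E1): ONE station = inner own-word bundle `[p, q]` + overhang bundle `[p(2 − U_A/U_max), p]` with the
FIXED corner objective `−X₀(p)`). Here (E1) is chained over a finite LADDER of stations `U_0 ≤ U_1 ≤ … ≤ U_m`: station `U_k` words the slab
`[p, q] × [U_k, U_{k+1}]` from its inner bundle and an overhang only to `p(2 − U_k/U_{k+1})`, asked for the corner objective — so every source word of
the whole construction has the a-priori scale of the box's own large-`|t′|` edge, no `U`-segment bundle is needed, and the overhang lengths shrink with
the ladder's density (La214-E `{29/5, 13/2, 8, 11, 74/5}`: overhangs to `−0.332, −0.356, −0.382, −0.377`, cf. `laBoxE_four_apexStations_overhangs`). The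
generic statement replaces the hand-chained three- and four-station instances of `…LaBoxE` (which asked the overhang sources for their OWN words).

* `exists_step_of_mem_Icc_chain` — a point of `[U_0, U_m]` lies in some step `[U_k, U_{k+1}]` of a monotone chain;
* `ObsStiffnessSeqCeilingAt_halfFilling_on_box_of_apexLadder_inner_and_cornerObjectiveOverhang` — THE LADDER THEOREM (families indexed by the
  station number `k < m`).

References: T. Koma, H. Tasaki, J. Stat. Phys. 76 (1994) 745, §1 [KomaTasaki1994]; D. J. Scalapino, S. R. White, S.-C. Zhang, PRB 47 (1993)
7995, §II [ScalapinoWhiteZhang1993].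
-/

noncomputable section

namespace Summit.Ventures.CertifiedManyBodySolver.Observables

open Literature.MathematicalPhysics.QuantumLattice
open Literature.MathematicalPhysics.QuantumLattice.ThermodynamicLimit
open Literature.MathematicalPhysics.QuantumFieldTheory
open Literature.Probability.LatticeModels
open Matrix Finset Filter Topology HubbardWave0
open scoped Matrix BigOperators ComplexOrder

/-- **A point of `[U_0, U_m]` lies in some step of the chain.** `U_k ≤ U_{k+1}` for `k < m`, `0 < m`, `x ∈ [U_0, U_m]` ⇒ `∃ k < m, x ∈ [U_k, U_{k+1}]`.
[folklore] -/
theorem exists_step_of_mem_Icc_chain {U : ℕ → ℝ} :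
    ∀ {m : ℕ}, 0 < m → (∀ k < m, U k ≤ U (k + 1)) → ∀ {x : ℝ}, x ∈ Set.Icc (U 0) (U m) →
      ∃ k < m, x ∈ Set.Icc (U k) (U (k + 1))
  | 0, hm, _, _, _ => absurd hm (lt_irrefl 0)
  | m + 1, _, hmono, x, hx => by
      by_cases hxm : U m < x
      · exact ⟨m, Nat.lt_succ_self m, hxm.le, hx.2⟩
      · rcases Nat.eq_zero_or_pos m with h0 | hpos
        · subst h0
          exact ⟨0, Nat.lt_succ_self 0, hx.1, hx.2⟩
        · obtain ⟨k, hk, hxk⟩ := exists_step_of_mem_Icc_chain hpos (fun k hk => hmono k (Nat.lt_succ_of_lt hk))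
            ⟨hx.1, not_lt.mp hxm⟩
          exact ⟨k, Nat.lt_succ_of_lt hk, hxk⟩

section Ladder

variable {p q : ℝ}

/-- **THE LADDER THEOREM (half filling).** Stations `U : ℕ → ℝ` with `0 < U_0`, `U_k ≤ U_{k+1}` for `k < m` (`0 < m`); targets `t′ ∈ [p, q]`,
`p ≤ q ≤ 0`. For every station `k < m`: an own-word orbit-lower family `valI k` on the INNER segment `[p, q] × {U_k}` and an orbit-lower family `valO k` for
the FIXED corner objective `−X₀(p)` on the short OVERHANG `[p(2 − U_k/U_{k+1}), p] × {U_k}`, with `−valI k s ≤ c`, `−valO k s ≤ c`. Then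
`ObsStiffnessSeqCeilingAt t′ u 1 c` at every `(t′, u) ∈ [p, q] × [U_0, U_m]` — (E1) of the companion on each slab `[U_k, U_{k+1}]`.
[cite: KomaTasaki1994, §1] [cite: ScalapinoWhiteZhang1993, §II] -/
theorem ObsStiffnessSeqCeilingAt_halfFilling_on_box_of_apexLadder_inner_and_cornerObjectiveOverhang (U : ℕ → ℝ) {m : ℕ} (hm : 0 < m)
    (hU0 : 0 < U 0) (hmono : ∀ k < m, U k ≤ U (k + 1)) (hpq : p ≤ q) (hq : q ≤ 0) (valI valO : ℕ → ℝ → ℝ) (c : ℚ)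
    (hI : ∀ k < m, ∀ s ∈ Set.Icc p q,
      ∀ (ω : InfVolFermionState 2) (Ls : ℕ → ℕ) (ψ : ∀ L, Fock (Orb (FermionTorus 2 L))),
      Tendsto Ls atTop atTop →
      (∀ j, IsGroundStateInSector (hubbardTorusTT' (Ls j) 1 s (U k)) (rectN 1 (Ls j)) 0 (ψ (Ls j))) →
      (∀ j, star (ψ (Ls j)) ⬝ᵥ ψ (Ls j) = 1) → ω.IsTorusLimitOf ψ Ls →
      valI k s ≤ ((Finset.univ : Finset (DihedralGroup 4)).card : ℝ)⁻¹ * ∑ g ∈ (Finset.univ : Finset (DihedralGroup 4)),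
        (ω.expect (d4ShiftSet g 0 (box 2 7)) (fermionEmbed (PolySite.d4Emb g 0 (box 2 7)) (-oddMomentObsTT s (U k) 0))).re)
    (hcI : ∀ k < m, ∀ s ∈ Set.Icc p q, -valI k s ≤ ((c : ℚ) : ℝ))
    (hO : ∀ k < m, ∀ s ∈ Set.Icc (p * (2 - U k / U (k + 1))) p,
      ∀ (ω : InfVolFermionState 2) (Ls : ℕ → ℕ) (ψ : ∀ L, Fock (Orb (FermionTorus 2 L))),
      Tendsto Ls atTop atTop →
      (∀ j, IsGroundStateInSector (hubbardTorusTT' (Ls j) 1 s (U k)) (rectN 1 (Ls j)) 0 (ψ (Ls j))) →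
      (∀ j, star (ψ (Ls j)) ⬝ᵥ ψ (Ls j) = 1) → ω.IsTorusLimitOf ψ Ls →
      valO k s ≤ ((Finset.univ : Finset (DihedralGroup 4)).card : ℝ)⁻¹ * ∑ g ∈ (Finset.univ : Finset (DihedralGroup 4)),
        (ω.expect (d4ShiftSet g 0 (box 2 7)) (fermionEmbed (PolySite.d4Emb g 0 (box 2 7)) (-oddMomentObsTT p (U k) 0))).re)
    (hcO : ∀ k < m, ∀ s ∈ Set.Icc (p * (2 - U k / U (k + 1))) p, -valO k s ≤ ((c : ℚ) : ℝ)) :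
    ∀ tp ∈ Set.Icc p q, ∀ u ∈ Set.Icc (U 0) (U m), ObsStiffnessSeqCeilingAt tp u 1 c := by
  -- every station is positive (the chain is monotone from `U_0 > 0`)
  have hpos : ∀ k, k ≤ m → 0 < U k := by
    intro k
    induction k with
    | zero => exact fun _ => hU0
    | succ j ih => exact fun hj => (ih (Nat.le_of_succ_le hj)).trans_le (hmono j (Nat.lt_of_succ_le hj))
  intro tp htp u hu
  obtain ⟨k, hk, huk⟩ := exists_step_of_mem_Icc_chain hm hmono hu
  exact ObsStiffnessSeqCeilingAt_halfFilling_on_box_of_apexStation_inner_and_cornerObjectiveOverhang (hpos k hk.le) (hmono k hk) hpq hq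
    (valI k) (valO k) c (hI k hk) (hcI k hk) (hO k hk) (hcO k hk) tp htp u huk

end Ladder

end Summit.Ventures.CertifiedManyBodySolver.Observables

end
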